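import Summits.QuantumAdvantage.QuantumAdvantage.Theorems.CubicForrelationSignedExactCubicForrelationNotPrBPPStubCoreReductionPrimeOrbit

/-!
# Crux `CubicForrelation.SignedExactCubicForrelationNotPrBPP` (stmt-QuantumAdvantage-13932), line `dual-pingpong-frame`
# (classify-then-count cut): stub `stub_coreReduction'` — THE RESHAPED GLUE

The registered stub `stub_coreReduction'` of the skeleton `Lines/classify_then_count.lean`, verbatim:
(H1) the classification of affine-free biquadratic permutations as cube-type (Conjecture BQ) →
(H2) the kernel statistics of the cube template at `(0,0)` → (H3) the core statement for orbit data with an affine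
component ("rich rectangular data") → (H4) the core statement for cube-orbit data ("cube block sums") → the live line's
core statement (kernel statistics at radical-absorbed closed orthogonal proper pairs).

Proof (the case analysis designed by worker W2, lead c4 reshape): fix the instance `C`, its orbit datum `(e, perm, h)`
and the pair `(S, U)`. EITHER some non-zero `u` has vanishing bilinear differential `u·B_perm ≡ 0` or `u·B_{perm⁻¹} ≡ 0`
— then the datum carries the extra conjunct of (H3), which is applied to the same instance and the same pair — OR
`perm` and `perm⁻¹` are affine-free; both have quadratic coordinates (`Covariance.perm_quadratic`: orbit transport of
the exact cubic pair and the dual Maiorana–McFarland shape), so (H1) makes `perm` cube-type, `m = 3k` by counting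
(`coreReduction_cubeBlocks`), `0 < k` as `0 ∈ S`, `|S| < 2^m` (`coreReduction_blocksPos`), and `Covariance.cubeOrbitDatum`
turns the cube-type datum into a cube-orbit datum `e' = e ∘ (N⁻ᵀ ‖ Λ₂⁻¹)` (with a linear term `ℓ·y'`) OF THE SAME
`b = (C 1).eval`; (H4) is then the goal for the same instance at the same pair, up to the cast `((3k : ℕ) : ℝ) = (k : ℝ)·3`
in the threshold.
(H2) is not used: it is the case `S = U = {0}` of (H4), kept registered as the explicit cube computation.

References: C. Carlet, *Boolean Functions for Cryptography and Coding Theory*, CUP 2021, §2.2.2, Prop. 54, Prop. 77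
[Carlet2020]; S. Aaronson, A. Ambainis, Forrelation, SIAM J. Comput. 47 (2018), §1.1.1 [AaronsonAmbainis2018]. -/

noncomputable section

set_option linter.dupNamespace false -- D-0017: single-problem summit ⇒ `QuantumAdvantage.QuantumAdvantage` by design

namespace Summit.QuantumAdvantage.QuantumAdvantage.Theorems.SignedExactCubicForrelationNotPrBPP

open Finset
open Literature.Computability.Complexity Literature.Computability.QuantumComplexity
open Literature.Computability.QuantumComplexity.BuzetChailloux (bxor zeroVec)
open Covariance

/-- **`0 < k` for a proper pair on `6k` bits** (registered brick `coreReduction_blocksPos` of stub `stub_coreReduction'`; the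
file's main theorem `stub_coreReduction'` exceeds the registry's signature length bound): a subspace `S ∋ 0` with
`|S| < 2^(3k)` forces `k ≠ 0`. [folklore] -/
theorem coreReduction_blocksPos : ∀ {k : ℕ} (S : Finset (Fin (k * 3 + k * 3) → Bool)), zeroVec ∈ S → S.card < 2 ^ (k * 3) → 0 < k := by
  intro k S h0 hlt
  rcases Nat.eq_zero_or_pos k with hk0 | hk0
  · exfalso
    subst hk0
    have h1 : 0 < S.card := Finset.card_pos.2 ⟨zeroVec, h0⟩
    have h2 : S.card < 1 := by simpa using hlt
    omega
  · exact hk0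

set_option maxHeartbeats 4000000 in
/-- **stub `stub_coreReduction'` (registered, line `dual-pingpong-frame`, classify-then-count cut): THE RESHAPED GLUE
(H1) ∧ (H2) ∧ (H3) ∧ (H4) ⇒ Core.** `by_cases` on the given orbit datum `(e, perm, h)`: an affine component on `perm`
or `perm⁻¹` is the extra conjunct of (H3) (same instance, same pair); otherwise `perm^{±1}` are quadratic
(`Covariance.perm_quadratic`) and affine-free, so cube-type by (H1), `m = 3k` (`coreReduction_cubeBlocks`), `0 < k`
(`coreReduction_blocksPos`: `0 ∈ S`, `|S| < 2^m`), and `Covariance.cubeOrbitDatum` gives a cube-orbit datum of the same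
`b`, to which (H4) applies at the same pair. (H2) is unused (it is (H4) at `S = U = {0}`).
[cite: Carlet2020, Prop. 54] [cite: AaronsonAmbainis2018, §1.1.1] -/
theorem stub_coreReduction' :
    (∀ (m : ℕ) (π : (Fin m → Bool) ≃ (Fin m → Bool)),
      (∀ i, IsDegLeFun 2 fun y => π y i) → (∀ i, IsDegLeFun 2 fun x => π.symm x i) →
      (∀ u : Fin m → Bool, u ≠ zeroVec → ∃ v w : Fin m → Bool,
        ((Finset.univ.filter fun i => u i && (π (bxor v w) i ^^ π v i ^^ π w i ^^ π zeroVec i)).card).bodd = true) →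
      (∀ u : Fin m → Bool, u ≠ zeroVec → ∃ v w : Fin m → Bool,
        ((Finset.univ.filter fun i => u i && (π.symm (bxor v w) i ^^ π.symm v i ^^ π.symm w i ^^ π.symm zeroVec i)).card).bodd = true) →
      ∃ (k : ℕ) (E₁ E₂ : (Fin m → Bool) ≃ (Fin k → Fin 3 → Bool)),
        (∀ x y i j, E₁ (bxor x y) i j = (E₁ x i j ^^ E₁ y i j ^^ E₁ zeroVec i j)) ∧
        (∀ x y i j, E₂ (bxor x y) i j = (E₂ x i j ^^ E₂ y i j ^^ E₂ zeroVec i j)) ∧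
        ∀ y i, E₁ (π y) i = (fun x : Fin 3 → Bool => (![x 0 ^^ x 1 ^^ x 2 ^^ (x 1 && x 2), (x 0 && x 1) ^^ (x 0 && x 2) ^^ x 1, (x 0 && x 1) ^^ x 2] : Fin 3 → Bool)) (E₂ y i)) →
    (∀ (k : ℕ), 0 < k → ∀ (h : (Fin (k * 3) → Bool) → Bool) (b : (Fin (k * 3 + k * 3) → Bool) → Bool),
      (∀ y' y'' : Fin (k * 3) → Bool, b (Fin.append y' y'') =
        (((Finset.univ.filter fun i => y' i &&
            (fun x : Fin 3 → Bool => (![x 0 ^^ x 1 ^^ x 2 ^^ (x 1 && x 2), (x 0 && x 1) ^^ (x 0 && x 2) ^^ x 1, (x 0 && x 1) ^^ x 2] : Fin 3 → Bool)) (fun s => y'' (finProdFinEquiv ((finProdFinEquiv.symm i).1, s))) (finProdFinEquiv.symm i).2).card).bodd ^^ h y'')) →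
      IsDegLeFun 3 b →
      (∃ r : ℕ, r ≤ k * 3 + k * 3 + 1 ∧ (2 : ℝ) ^ ((k * 3 + k * 3) * r) / ((k * 3 + k * 3 + 2 : ℝ) ^ 8) ≤ (∑ xs : Fin (r) → (Fin (k * 3 + k * 3) → Bool), (((@Finset.filter (Fin (k * 3 + k * 3) → Bool) (fun v => v ∉ ({zeroVec} : Finset (Fin (k * 3 + k * 3) → Bool)) ∧ (∃ V : Finset (Fin (k * 3 + k * 3) → Bool), ((zeroVec ∈ V ∧ ∀ x ∈ V, ∀ y ∈ V, bxor x y ∈ V) ∧ (((V).card : ℝ) ^ 2 = (2 : ℝ) ^ (k * 3 + k * 3)) ∧ ∀ u ∈ V, ∀ v ∈ V, ∀ x, (b x ^^ b (bxor x u) ^^ b (bxor x v) ^^ b (bxor x (bxor u v))) = false) ∧ ({zeroVec} : Finset (Fin (k * 3 + k * 3) → Bool)) ⊆ V ∧ v ∈ V ∧ (∀ s ∈ V, ∀ u ∈ ({zeroVec} : Finset (Fin (k * 3 + k * 3) → Bool)), ((Finset.univ.filter fun i => s i && u i).card).bodd = false))) (Classical.decPred _) (Finset.univ.filter fun (v :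 Fin (k * 3 + k * 3) → Bool) => (∀ s ∈ ({zeroVec} : Finset (Fin (k * 3 + k * 3) → Bool)), ∀ x, (b x ^^ b (bxor x s) ^^ b (bxor x v) ^^ b (bxor x (bxor s v))) = false) ∧ (∀ u ∈ ({zeroVec} : Finset (Fin (k * 3 + k * 3) → Bool)), ((Finset.univ.filter fun i => u i && v i).card).bodd = false) ∧ ∀ j, (∀ y z : Fin (k * 3 + k * 3) → Bool, ((b z ^^ b (bxor z (xs j)) ^^ b (bxor z v) ^^ b (bxor z (bxor (xs j) v))) ^^ (b (bxor z y) ^^ b (bxor (bxor z y) (xs j)) ^^ b (bxor (bxor z y) v) ^^ b (bxor (bxor z y) (bxor (xs j) v)))) = false))).card : ℝ) / (((Finset.univ.filter fun (v : Fin (k * 3 + k * 3) → Bool) => (∀ s ∈ ({zeroVec} : Finset (Fin (k * 3 + k * 3) → Bool)), ∀ x, (b x ^^ b (bxor x s) ^^ b (bxor x v) ^^ b (bxor x (bxor s v))) = false) ∧ (∀ u ∈ ({zeroVec} : Finset (Fin (k * 3 + k * 3) → Bool)), ((Finset.univ.filter fun i => u i && v i).card).bodd = false) ∧ ∀ j,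 (∀ y z : Fin (k * 3 + k * 3) → Bool, ((b z ^^ b (bxor z (xs j)) ^^ b (bxor z v) ^^ b (bxor z (bxor (xs j) v))) ^^ (b (bxor z y) ^^ b (bxor (bxor z y) (xs j)) ^^ b (bxor (bxor z y) v) ^^ b (bxor (bxor z y) (bxor (xs j) v)))) = false))).card : ℝ))))) →
    (∀ (m : ℕ) (C : Fin 2 → Circuit (Fin (m + m))),
        (⟨m + m, 2, C⟩ : KForrelationInstance).IsOverB2 →
        (∀ i, IsDegLeFun 3 (C i).eval) →
        (forrelation (C 0).eval (C 1).eval = 1 ∨ forrelation (C 0).eval (C 1).eval = -1) →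
        (∃ e : (Fin (m + m) → Bool) ≃ (Fin (m + m) → Bool),
          (∃ M : Matrix (Fin (m + m)) (Fin (m + m)) (ZMod 2), ∃ c : Fin (m + m) → ZMod 2,
            ∀ y i, (if e y i then (1 : ZMod 2) else 0) = (M.mulVec (fun j => if y j then (1 : ZMod 2) else 0) + c) i) ∧
          ∃ perm : (Fin m → Bool) ≃ (Fin m → Bool), ∃ h : (Fin m → Bool) → Bool, (∀ y' y'' : Fin m → Bool,
            (if (C 1).eval (e (Fin.append y' y'')) then (1 : ZMod 2) else 0) =
              (∑ i, (if y' i then (1 : ZMod 2) else 0) * (if perm y'' i then (1 : ZMod 2) else 0)) +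
                (if h y'' then (1 : ZMod 2) else 0)) ∧
            (∃ u : Fin m → Bool, u ≠ zeroVec ∧
              ((∀ v w : Fin m → Bool, ((Finset.univ.filter fun i => u i && (perm (bxor v w) i ^^ perm v i ^^ perm w i ^^ perm zeroVec i)).card).bodd = false) ∨
               (∀ v w : Fin m → Bool, ((Finset.univ.filter fun i => u i && (perm.symm (bxor v w) i ^^ perm.symm v i ^^ perm.symm w i ^^ perm.symm zeroVec i)).card).bodd = false)))) →
        ∀ S U : Finset (Fin (m + m) → Bool),
          (zeroVec ∈ S ∧ ∀ x ∈ S, ∀ y ∈ S, bxor x y ∈ S) → (zeroVec ∈ U ∧ ∀ x ∈ U, ∀ y ∈ U, bxor x y ∈ U) →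
          ((∀ s ∈ S, ∀ y : Fin (m + m) → Bool, (fun k => ((C 1).eval zeroVec ^^ (C 1).eval (bxor zeroVec s) ^^ (C 1).eval (bxor zeroVec y) ^^ (C 1).eval (bxor zeroVec (bxor s y))) ^^ ((C 1).eval (fun j => decide (j = k)) ^^ (C 1).eval (bxor (fun j => decide (j = k)) s) ^^ (C 1).eval (bxor (fun j => decide (j = k)) y) ^^ (C 1).eval (bxor (fun j => decide (j = k)) (bxor s y)))) ∈ U) ∧ (∀ s ∈ S, ∃ ℓ ∈ U, ∀ r : Fin (m + m) → Bool, (∀ y z : Fin (m + m) → Bool, (((C 1).eval z ^^ (C 1).eval (bxor z s) ^^ (C 1).eval (bxor z r) ^^ (C 1).eval (bxor z (bxor s r))) ^^ ((C 1).eval (bxor z y) ^^ (C 1).eval (bxor (bxor z y) s) ^^ (C 1).eval (bxor (bxor z y) r) ^^ (C 1).eval (bxor (bxor z y) (bxor s r)))) = false) → ((C 1).eval r ^^ (C 1).eval (bxor r s) ^^ (C 1).eval zeroVec ^^ (C 1).eval s) = ((Finset.univ.filter fun i => ℓ i && r i).card).bodd)) →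
          ((∀ s ∈ U, ∀ y : Fin (m + m) → Bool, (fun k => ((C 0).eval zeroVec ^^ (C 0).eval (bxor zeroVec s) ^^ (C 0).eval (bxor zeroVec y) ^^ (C 0).eval (bxor zeroVec (bxor s y))) ^^ ((C 0).eval (fun j => decide (j = k)) ^^ (C 0).eval (bxor (fun j => decide (j = k)) s) ^^ (C 0).eval (bxor (fun j => decide (j = k)) y) ^^ (C 0).eval (bxor (fun j => decide (j = k)) (bxor s y)))) ∈ S) ∧ (∀ s ∈ U, ∃ ℓ ∈ S, ∀ r : Fin (m + m) → Bool, (∀ y z : Fin (m + m) → Bool, (((C 0).eval z ^^ (C 0).eval (bxor z s) ^^ (C 0).eval (bxor z r) ^^ (C 0).eval (bxor z (bxor s r))) ^^ ((C 0).eval (bxor z y) ^^ (C 0).eval (bxor (bxor z y) s) ^^ (C 0).eval (bxor (bxor z y) r) ^^ (C 0).eval (bxor (bxor z y) (bxor s r)))) = false) → ((C 0).eval r ^^ (C 0).eval (bxor r s) ^^ (C 0).eval zeroVec ^^ (C 0).eval s) = ((Finset.univ.filter fun i => ℓ i && r i).card).bodd)) →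
          (∀ s ∈ S, ∀ u ∈ U, ((Finset.univ.filter fun i => s i && u i).card).bodd = false) →
          S.card < 2 ^ m → U.card < 2 ^ m →
          (¬ ∃ v : Fin (m + m) → Bool, (∀ x y z : Fin (m + m) → Bool, (((C 1).eval z ^^ (C 1).eval (bxor z x) ^^ (C 1).eval (bxor z v) ^^ (C 1).eval (bxor z (bxor x v))) ^^ ((C 1).eval (bxor z y) ^^ (C 1).eval (bxor (bxor z y) x) ^^ (C 1).eval (bxor (bxor z y) v) ^^ (C 1).eval (bxor (bxor z y) (bxor x v)))) = false) ∧ (∀ s ∈ S, ∀ x, ((C 1).eval x ^^ (C 1).eval (bxor x s) ^^ (C 1).eval (bxor x v) ^^ (C 1).eval (bxor x (bxor s v))) = false) ∧ (∀ u ∈ U, ((Finset.univ.filter fun i => u i && v i).card).bodd = false) ∧ v ∉ S) →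
          (¬ ∃ v : Fin (m + m) → Bool, (∀ x y z : Fin (m + m) → Bool, (((C 0).eval z ^^ (C 0).eval (bxor z x) ^^ (C 0).eval (bxor z v) ^^ (C 0).eval (bxor z (bxor x v))) ^^ ((C 0).eval (bxor z y) ^^ (C 0).eval (bxor (bxor z y) x) ^^ (C 0).eval (bxor (bxor z y) v) ^^ (C 0).eval (bxor (bxor z y) (bxor x v)))) = false) ∧ (∀ s ∈ U, ∀ x, ((C 0).eval x ^^ (C 0).eval (bxor x s) ^^ (C 0).eval (bxor x v) ^^ (C 0).eval (bxor x (bxor s v))) = false) ∧ (∀ u ∈ S, ((Finset.univ.filter fun i => u i && v i).card).bodd = false) ∧ v ∉ U) →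
          (∃ r : ℕ, r ≤ m + m + 1 ∧ (2 : ℝ) ^ ((m + m) * r) / ((m + m + 2 : ℝ) ^ 8) ≤ (∑ xs : Fin (r) → (Fin (m + m) → Bool), (((@Finset.filter (Fin (m + m) → Bool) (fun v => v ∉ S ∧ (∃ V : Finset (Fin (m + m) → Bool), ((zeroVec ∈ V ∧ ∀ x ∈ V, ∀ y ∈ V, bxor x y ∈ V) ∧ (((V).card : ℝ) ^ 2 = (2 : ℝ) ^ (m + m)) ∧ ∀ u ∈ V, ∀ v ∈ V, ∀ x, ((C 1).eval x ^^ (C 1).eval (bxor x u) ^^ (C 1).eval (bxor x v) ^^ (C 1).eval (bxor x (bxor u v))) = false) ∧ S ⊆ V ∧ v ∈ V ∧ (∀ s ∈ V, ∀ u ∈ U, ((Finset.univ.filter fun i => s i && u i).card).bodd = false))) (Classical.decPred _) (Finset.univ.filter fun (v : Fin (m + m) → Bool) => (∀ s ∈ S, ∀ x, ((C 1).eval x ^^ (C 1).eval (bxor x s) ^^ (C 1).eval (bxor x v) ^^ (C 1).eval (bxor x (bxor s v))) = false) ∧ (∀ u ∈ U, ((Finset.univ.filter fun i => u i && v i).card).bodd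 = false) ∧ ∀ j, (∀ y z : Fin (m + m) → Bool, (((C 1).eval z ^^ (C 1).eval (bxor z (xs j)) ^^ (C 1).eval (bxor z v) ^^ (C 1).eval (bxor z (bxor (xs j) v))) ^^ ((C 1).eval (bxor z y) ^^ (C 1).eval (bxor (bxor z y) (xs j)) ^^ (C 1).eval (bxor (bxor z y) v) ^^ (C 1).eval (bxor (bxor z y) (bxor (xs j) v)))) = false))).card : ℝ) / (((Finset.univ.filter fun (v : Fin (m + m) → Bool) => (∀ s ∈ S, ∀ x, ((C 1).eval x ^^ (C 1).eval (bxor x s) ^^ (C 1).eval (bxor x v) ^^ (C 1).eval (bxor x (bxor s v))) = false) ∧ (∀ u ∈ U, ((Finset.univ.filter fun i => u i && v i).card).bodd = false) ∧ ∀ j, (∀ y z : Fin (m + m) → Bool, (((C 1).eval z ^^ (C 1).eval (bxor z (xs j)) ^^ (C 1).eval (bxor z v) ^^ (C 1).eval (bxor z (bxor (xs j) v))) ^^ ((C 1).eval (bxor z y) ^^ (C 1).eval (bxor (bxor z y) (xs j)) ^^ (C 1).eval (bxor (bxor z y) v) ^^ (C 1).eval (bxor (bxor z y) (bxor (xs j)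 v)))) = false))).card : ℝ)))) ∨
          (∃ r : ℕ, r ≤ m + m + 1 ∧ (2 : ℝ) ^ ((m + m) * r) / ((m + m + 2 : ℝ) ^ 8) ≤ (∑ xs : Fin (r) → (Fin (m + m) → Bool), (((@Finset.filter (Fin (m + m) → Bool) (fun v => v ∉ U ∧ (∃ V : Finset (Fin (m + m) → Bool), ((zeroVec ∈ V ∧ ∀ x ∈ V, ∀ y ∈ V, bxor x y ∈ V) ∧ (((V).card : ℝ) ^ 2 = (2 : ℝ) ^ (m + m)) ∧ ∀ u ∈ V, ∀ v ∈ V, ∀ x, ((C 0).eval x ^^ (C 0).eval (bxor x u) ^^ (C 0).eval (bxor x v) ^^ (C 0).eval (bxor x (bxor u v))) = false) ∧ U ⊆ V ∧ v ∈ V ∧ (∀ s ∈ V, ∀ u ∈ S, ((Finset.univ.filter fun i => s i && u i).card).bodd = false))) (Classical.decPred _) (Finset.univ.filter fun (v : Fin (m + m) → Bool) => (∀ s ∈ U, ∀ x, ((C 0).eval x ^^ (C 0).eval (bxor x s) ^^ (C 0).eval (bxor x v) ^^ (C 0).eval (bxor x (bxor s v))) = false) ∧ (∀ u ∈ S, ((Finset.univ.filter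 fun i => u i && v i).card).bodd = false) ∧ ∀ j, (∀ y z : Fin (m + m) → Bool, (((C 0).eval z ^^ (C 0).eval (bxor z (xs j)) ^^ (C 0).eval (bxor z v) ^^ (C 0).eval (bxor z (bxor (xs j) v))) ^^ ((C 0).eval (bxor z y) ^^ (C 0).eval (bxor (bxor z y) (xs j)) ^^ (C 0).eval (bxor (bxor z y) v) ^^ (C 0).eval (bxor (bxor z y) (bxor (xs j) v)))) = false))).card : ℝ) / (((Finset.univ.filter fun (v : Fin (m + m) → Bool) => (∀ s ∈ U, ∀ x, ((C 0).eval x ^^ (C 0).eval (bxor x s) ^^ (C 0).eval (bxor x v) ^^ (C 0).eval (bxor x (bxor s v))) = false) ∧ (∀ u ∈ S, ((Finset.univ.filter fun i => u i && v i).card).bodd = false) ∧ ∀ j, (∀ y z : Fin (m + m) → Bool, (((C 0).eval z ^^ (C 0).eval (bxor z (xs j)) ^^ (C 0).eval (bxor z v) ^^ (C 0).eval (bxor z (bxor (xs j) v))) ^^ ((C 0).eval (bxor z y) ^^ (C 0).eval (bxor (bxor z y) (xs j)) ^^ (C 0).eval (bxor (bxor z y) v) ^^ (C 0).eval (bxor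 (bxor z y) (bxor (xs j) v)))) = false))).card : ℝ))))) →
    (∀ (k : ℕ), 0 < k → ∀ (C : Fin 2 → Circuit (Fin (k * 3 + k * 3))),
        (⟨k * 3 + k * 3, 2, C⟩ : KForrelationInstance).IsOverB2 →
        (∀ i, IsDegLeFun 3 (C i).eval) →
        (forrelation (C 0).eval (C 1).eval = 1 ∨ forrelation (C 0).eval (C 1).eval = -1) →
        (∃ e : (Fin (k * 3 + k * 3) → Bool) ≃ (Fin (k * 3 + k * 3) → Bool),
          (∃ M : Matrix (Fin (k * 3 + k * 3)) (Fin (k * 3 + k * 3)) (ZMod 2), ∃ c : Fin (k * 3 + k * 3) → ZMod 2,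
            ∀ y i, (if e y i then (1 : ZMod 2) else 0) = (M.mulVec (fun j => if y j then (1 : ZMod 2) else 0) + c) i) ∧
          ∃ h : (Fin (k * 3) → Bool) → Bool, ∃ ℓ : Fin (k * 3) → Bool, ∀ y' y'' : Fin (k * 3) → Bool,
            (if (C 1).eval (e (Fin.append y' y'')) then (1 : ZMod 2) else 0) =
              (∑ i, (if y' i then (1 : ZMod 2) else 0) * (if (fun x : Fin 3 → Bool => (![x 0 ^^ x 1 ^^ x 2 ^^ (x 1 && x 2), (x 0 && x 1) ^^ (x 0 && x 2) ^^ x 1, (x 0 && x 1) ^^ x 2] : Fin 3 → Bool)) (fun s => y'' (finProdFinEquiv ((finProdFinEquiv.symm i).1, s))) (finProdFinEquiv.symm i).2 then (1 : ZMod 2) else 0)) +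
                (if h y'' then (1 : ZMod 2) else 0) + (∑ i, (if y' i then (1 : ZMod 2) else 0) * (if ℓ i then (1 : ZMod 2) else 0))) →
        ∀ S U : Finset (Fin (k * 3 + k * 3) → Bool),
          (zeroVec ∈ S ∧ ∀ x ∈ S, ∀ y ∈ S, bxor x y ∈ S) → (zeroVec ∈ U ∧ ∀ x ∈ U, ∀ y ∈ U, bxor x y ∈ U) →
          ((∀ s ∈ S, ∀ y : Fin (k * 3 + k * 3) → Bool, (fun k => ((C 1).eval zeroVec ^^ (C 1).eval (bxor zeroVec s) ^^ (C 1).eval (bxor zeroVec y) ^^ (C 1).eval (bxor zeroVec (bxor s y))) ^^ ((C 1).eval (fun j => decide (j = k)) ^^ (C 1).eval (bxor (fun j => decide (j = k)) s) ^^ (C 1).eval (bxor (fun j => decide (j = k)) y) ^^ (C 1).eval (bxor (fun j => decide (j = k)) (bxor s y)))) ∈ U) ∧ (∀ s ∈ S, ∃ ℓ ∈ U, ∀ r : Fin (k * 3 + k * 3) → Bool, (∀ y z : Fin (k * 3 + k * 3) → Bool, (((C 1).eval z ^^ (C 1).eval (bxor z s) ^^ (C 1).eval (bxor z r) ^^ (C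 1).eval (bxor z (bxor s r))) ^^ ((C 1).eval (bxor z y) ^^ (C 1).eval (bxor (bxor z y) s) ^^ (C 1).eval (bxor (bxor z y) r) ^^ (C 1).eval (bxor (bxor z y) (bxor s r)))) = false) → ((C 1).eval r ^^ (C 1).eval (bxor r s) ^^ (C 1).eval zeroVec ^^ (C 1).eval s) = ((Finset.univ.filter fun i => ℓ i && r i).card).bodd)) →
          ((∀ s ∈ U, ∀ y : Fin (k * 3 + k * 3) → Bool, (fun k => ((C 0).eval zeroVec ^^ (C 0).eval (bxor zeroVec s) ^^ (C 0).eval (bxor zeroVec y) ^^ (C 0).eval (bxor zeroVec (bxor s y))) ^^ ((C 0).eval (fun j => decide (j = k)) ^^ (C 0).eval (bxor (fun j => decide (j = k)) s) ^^ (C 0).eval (bxor (fun j => decide (j = k)) y) ^^ (C 0).eval (bxor (fun j => decide (j = k)) (bxor s y)))) ∈ S) ∧ (∀ s ∈ U, ∃ ℓ ∈ S, ∀ r : Fin (k * 3 + k * 3) → Bool, (∀ y z : Fin (k * 3 + k * 3) → Bool, (((C 0).eval z ^^ (C 0).eval (bxor z s) ^^ (C 0).eval (bxor z r) ^^ (C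 0).eval (bxor z (bxor s r))) ^^ ((C 0).eval (bxor z y) ^^ (C 0).eval (bxor (bxor z y) s) ^^ (C 0).eval (bxor (bxor z y) r) ^^ (C 0).eval (bxor (bxor z y) (bxor s r)))) = false) → ((C 0).eval r ^^ (C 0).eval (bxor r s) ^^ (C 0).eval zeroVec ^^ (C 0).eval s) = ((Finset.univ.filter fun i => ℓ i && r i).card).bodd)) →
          (∀ s ∈ S, ∀ u ∈ U, ((Finset.univ.filter fun i => s i && u i).card).bodd = false) →
          S.card < 2 ^ (k * 3) → U.card < 2 ^ (k * 3) →
          (¬ ∃ v : Fin (k * 3 + k * 3) → Bool, (∀ x y z : Fin (k * 3 + k * 3) → Bool, (((C 1).eval z ^^ (C 1).eval (bxor z x) ^^ (C 1).eval (bxor z v) ^^ (C 1).eval (bxor z (bxor x v))) ^^ ((C 1).eval (bxor z y) ^^ (C 1).eval (bxor (bxor z y) x) ^^ (C 1).eval (bxor (bxor z y) v) ^^ (C 1).eval (bxor (bxor z y) (bxor x v)))) = false) ∧ (∀ s ∈ S, ∀ x, ((C 1).eval x ^^ (C 1).eval (bxor x s) ^^ (C 1).eval (bxor x v) ^^ (C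 1).eval (bxor x (bxor s v))) = false) ∧ (∀ u ∈ U, ((Finset.univ.filter fun i => u i && v i).card).bodd = false) ∧ v ∉ S) →
          (¬ ∃ v : Fin (k * 3 + k * 3) → Bool, (∀ x y z : Fin (k * 3 + k * 3) → Bool, (((C 0).eval z ^^ (C 0).eval (bxor z x) ^^ (C 0).eval (bxor z v) ^^ (C 0).eval (bxor z (bxor x v))) ^^ ((C 0).eval (bxor z y) ^^ (C 0).eval (bxor (bxor z y) x) ^^ (C 0).eval (bxor (bxor z y) v) ^^ (C 0).eval (bxor (bxor z y) (bxor x v)))) = false) ∧ (∀ s ∈ U, ∀ x, ((C 0).eval x ^^ (C 0).eval (bxor x s) ^^ (C 0).eval (bxor x v) ^^ (C 0).eval (bxor x (bxor s v))) = false) ∧ (∀ u ∈ S, ((Finset.univ.filter fun i => u i && v i).card).bodd = false) ∧ v ∉ U) →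
          (∃ r : ℕ, r ≤ k * 3 + k * 3 + 1 ∧ (2 : ℝ) ^ ((k * 3 + k * 3) * r) / ((k * 3 + k * 3 + 2 : ℝ) ^ 8) ≤ (∑ xs : Fin (r) → (Fin (k * 3 + k * 3) → Bool), (((@Finset.filter (Fin (k * 3 + k * 3) → Bool) (fun v => v ∉ S ∧ (∃ V : Finset (Fin (k * 3 + k * 3) → Bool), ((zeroVec ∈ V ∧ ∀ x ∈ V, ∀ y ∈ V, bxor x y ∈ V) ∧ (((V).card : ℝ) ^ 2 = (2 : ℝ) ^ (k * 3 + k * 3)) ∧ ∀ u ∈ V, ∀ v ∈ V, ∀ x, ((C 1).eval x ^^ (C 1).eval (bxor x u) ^^ (C 1).eval (bxor x v) ^^ (C 1).eval (bxor x (bxor u v))) = false) ∧ S ⊆ V ∧ v ∈ V ∧ (∀ s ∈ V, ∀ u ∈ U, ((Finset.univ.filter fun i => s i && u i).card).bodd = false))) (Classical.decPred _) (Finset.univ.filter fun (v : Fin (k * 3 + k * 3) → Bool) => (∀ s ∈ S, ∀ x, ((C 1).eval x ^^ (C 1).eval (bxor x s) ^^ (C 1).eval (bxor x v) ^^ (C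 1).eval (bxor x (bxor s v))) = false) ∧ (∀ u ∈ U, ((Finset.univ.filter fun i => u i && v i).card).bodd = false) ∧ ∀ j, (∀ y z : Fin (k * 3 + k * 3) → Bool, (((C 1).eval z ^^ (C 1).eval (bxor z (xs j)) ^^ (C 1).eval (bxor z v) ^^ (C 1).eval (bxor z (bxor (xs j) v))) ^^ ((C 1).eval (bxor z y) ^^ (C 1).eval (bxor (bxor z y) (xs j)) ^^ (C 1).eval (bxor (bxor z y) v) ^^ (C 1).eval (bxor (bxor z y) (bxor (xs j) v)))) = false))).card : ℝ) / (((Finset.univ.filter fun (v : Fin (k * 3 + k * 3) → Bool) => (∀ s ∈ S, ∀ x, ((C 1).eval x ^^ (C 1).eval (bxor x s) ^^ (C 1).eval (bxor x v) ^^ (C 1).eval (bxor x (bxor s v))) = false) ∧ (∀ u ∈ U, ((Finset.univ.filter fun i => u i && v i).card).bodd = false) ∧ ∀ j, (∀ y z : Fin (k * 3 + k * 3) → Bool, (((C 1).eval z ^^ (C 1).eval (bxor z (xs j)) ^^ (C 1).eval (bxor z v) ^^ (C 1).eval (bxor z (bxor (xs j) v))) ^^ ((C 1).eval (bxor z y)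 ^^ (C 1).eval (bxor (bxor z y) (xs j)) ^^ (C 1).eval (bxor (bxor z y) v) ^^ (C 1).eval (bxor (bxor z y) (bxor (xs j) v)))) = false))).card : ℝ)))) ∨
          (∃ r : ℕ, r ≤ k * 3 + k * 3 + 1 ∧ (2 : ℝ) ^ ((k * 3 + k * 3) * r) / ((k * 3 + k * 3 + 2 : ℝ) ^ 8) ≤ (∑ xs : Fin (r) → (Fin (k * 3 + k * 3) → Bool), (((@Finset.filter (Fin (k * 3 + k * 3) → Bool) (fun v => v ∉ U ∧ (∃ V : Finset (Fin (k * 3 + k * 3) → Bool), ((zeroVec ∈ V ∧ ∀ x ∈ V, ∀ y ∈ V, bxor x y ∈ V) ∧ (((V).card : ℝ) ^ 2 = (2 : ℝ) ^ (k * 3 + k * 3)) ∧ ∀ u ∈ V, ∀ v ∈ V, ∀ x, ((C 0).eval x ^^ (C 0).eval (bxor x u) ^^ (C 0).eval (bxor x v) ^^ (C 0).eval (bxor x (bxor u v))) = false) ∧ U ⊆ V ∧ v ∈ V ∧ (∀ s ∈ V, ∀ u ∈ S, ((Finset.univ.filter fun i => s i && u i).card).bodd = false))) (Classical.decPred _)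 (Finset.univ.filter fun (v : Fin (k * 3 + k * 3) → Bool) => (∀ s ∈ U, ∀ x, ((C 0).eval x ^^ (C 0).eval (bxor x s) ^^ (C 0).eval (bxor x v) ^^ (C 0).eval (bxor x (bxor s v))) = false) ∧ (∀ u ∈ S, ((Finset.univ.filter fun i => u i && v i).card).bodd = false) ∧ ∀ j, (∀ y z : Fin (k * 3 + k * 3) → Bool, (((C 0).eval z ^^ (C 0).eval (bxor z (xs j)) ^^ (C 0).eval (bxor z v) ^^ (C 0).eval (bxor z (bxor (xs j) v))) ^^ ((C 0).eval (bxor z y) ^^ (C 0).eval (bxor (bxor z y) (xs j)) ^^ (C 0).eval (bxor (bxor z y) v) ^^ (C 0).eval (bxor (bxor z y) (bxor (xs j) v)))) = false))).card : ℝ) / (((Finset.univ.filter fun (v : Fin (k * 3 + k * 3) → Bool) => (∀ s ∈ U, ∀ x, ((C 0).eval x ^^ (C 0).eval (bxor x s) ^^ (C 0).eval (bxor x v) ^^ (C 0).eval (bxor x (bxor s v))) = false) ∧ (∀ u ∈ S, ((Finset.univ.filter fun i => u i && v i).card).bodd = false) ∧ ∀ j, (∀ y z : Fin (k * 3 + k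 * 3) → Bool, (((C 0).eval z ^^ (C 0).eval (bxor z (xs j)) ^^ (C 0).eval (bxor z v) ^^ (C 0).eval (bxor z (bxor (xs j) v))) ^^ ((C 0).eval (bxor z y) ^^ (C 0).eval (bxor (bxor z y) (xs j)) ^^ (C 0).eval (bxor (bxor z y) v) ^^ (C 0).eval (bxor (bxor z y) (bxor (xs j) v)))) = false))).card : ℝ))))) →
    ∀ (m : ℕ) (C : Fin 2 → Circuit (Fin (m + m))),
        (⟨m + m, 2, C⟩ : KForrelationInstance).IsOverB2 →
        (∀ i, IsDegLeFun 3 (C i).eval) →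
        (forrelation (C 0).eval (C 1).eval = 1 ∨ forrelation (C 0).eval (C 1).eval = -1) →
        (∃ e : (Fin (m + m) → Bool) ≃ (Fin (m + m) → Bool),
          (∃ M : Matrix (Fin (m + m)) (Fin (m + m)) (ZMod 2), ∃ c : Fin (m + m) → ZMod 2,
            ∀ y i, (if e y i then (1 : ZMod 2) else 0) = (M.mulVec (fun j => if y j then (1 : ZMod 2) else 0) + c) i) ∧
          ∃ perm : (Fin m → Bool) ≃ (Fin m → Bool), ∃ h : (Fin m → Bool) → Bool, ∀ y' y'' : Fin m → Bool,
            (if (C 1).eval (e (Fin.append y' y'')) then (1 : ZMod 2) else 0) =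
              (∑ i, (if y' i then (1 : ZMod 2) else 0) * (if perm y'' i then (1 : ZMod 2) else 0)) +
                (if h y'' then (1 : ZMod 2) else 0)) →
        ∀ S U : Finset (Fin (m + m) → Bool),
          (zeroVec ∈ S ∧ ∀ x ∈ S, ∀ y ∈ S, bxor x y ∈ S) → (zeroVec ∈ U ∧ ∀ x ∈ U, ∀ y ∈ U, bxor x y ∈ U) →
          ((∀ s ∈ S, ∀ y : Fin (m + m) → Bool, (fun k => ((C 1).eval zeroVec ^^ (C 1).eval (bxor zeroVec s) ^^ (C 1).eval (bxor zeroVec y) ^^ (C 1).eval (bxor zeroVec (bxor s y))) ^^ ((C 1).eval (fun j => decide (j = k)) ^^ (C 1).eval (bxor (fun j => decide (j = k)) s) ^^ (C 1).eval (bxor (fun j => decide (j = k)) y) ^^ (C 1).eval (bxor (fun j => decide (j = k)) (bxor s y)))) ∈ U) ∧ (∀ s ∈ S, ∃ ℓ ∈ U, ∀ r : Fin (m + m) → Bool, (∀ y z : Fin (m + m) → Bool, (((C 1).eval z ^^ (C 1).eval (bxor z s) ^^ (C 1).eval (bxor z r) ^^ (C 1).eval (bxor z (bxor s r))) ^^ ((C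 1).eval (bxor z y) ^^ (C 1).eval (bxor (bxor z y) s) ^^ (C 1).eval (bxor (bxor z y) r) ^^ (C 1).eval (bxor (bxor z y) (bxor s r)))) = false) → ((C 1).eval r ^^ (C 1).eval (bxor r s) ^^ (C 1).eval zeroVec ^^ (C 1).eval s) = ((Finset.univ.filter fun i => ℓ i && r i).card).bodd)) →
          ((∀ s ∈ U, ∀ y : Fin (m + m) → Bool, (fun k => ((C 0).eval zeroVec ^^ (C 0).eval (bxor zeroVec s) ^^ (C 0).eval (bxor zeroVec y) ^^ (C 0).eval (bxor zeroVec (bxor s y))) ^^ ((C 0).eval (fun j => decide (j = k)) ^^ (C 0).eval (bxor (fun j => decide (j = k)) s) ^^ (C 0).eval (bxor (fun j => decide (j = k)) y) ^^ (C 0).eval (bxor (fun j => decide (j = k)) (bxor s y)))) ∈ S) ∧ (∀ s ∈ U, ∃ ℓ ∈ S, ∀ r : Fin (m + m) → Bool, (∀ y z : Fin (m + m) → Bool, (((C 0).eval z ^^ (C 0).eval (bxor z s) ^^ (C 0).eval (bxor z r) ^^ (C 0).eval (bxor z (bxor s r))) ^^ ((C 0).eval (bxor z y) ^^ (C 0).eval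 (bxor (bxor z y) s) ^^ (C 0).eval (bxor (bxor z y) r) ^^ (C 0).eval (bxor (bxor z y) (bxor s r)))) = false) → ((C 0).eval r ^^ (C 0).eval (bxor r s) ^^ (C 0).eval zeroVec ^^ (C 0).eval s) = ((Finset.univ.filter fun i => ℓ i && r i).card).bodd)) →
          (∀ s ∈ S, ∀ u ∈ U, ((Finset.univ.filter fun i => s i && u i).card).bodd = false) →
          S.card < 2 ^ m → U.card < 2 ^ m →
          (¬ ∃ v : Fin (m + m) → Bool, (∀ x y z : Fin (m + m) → Bool, (((C 1).eval z ^^ (C 1).eval (bxor z x) ^^ (C 1).eval (bxor z v) ^^ (C 1).eval (bxor z (bxor x v))) ^^ ((C 1).eval (bxor z y) ^^ (C 1).eval (bxor (bxor z y) x) ^^ (C 1).eval (bxor (bxor z y) v) ^^ (C 1).eval (bxor (bxor z y) (bxor x v)))) = false) ∧ (∀ s ∈ S, ∀ x, ((C 1).eval x ^^ (C 1).eval (bxor x s) ^^ (C 1).eval (bxor x v) ^^ (C 1).eval (bxor x (bxor s v))) = false) ∧ (∀ u ∈ U, ((Finset.univ.filter fun i => u i && v i).card).bodd = false) ∧ v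 ∉ S) →
          (¬ ∃ v : Fin (m + m) → Bool, (∀ x y z : Fin (m + m) → Bool, (((C 0).eval z ^^ (C 0).eval (bxor z x) ^^ (C 0).eval (bxor z v) ^^ (C 0).eval (bxor z (bxor x v))) ^^ ((C 0).eval (bxor z y) ^^ (C 0).eval (bxor (bxor z y) x) ^^ (C 0).eval (bxor (bxor z y) v) ^^ (C 0).eval (bxor (bxor z y) (bxor x v)))) = false) ∧ (∀ s ∈ U, ∀ x, ((C 0).eval x ^^ (C 0).eval (bxor x s) ^^ (C 0).eval (bxor x v) ^^ (C 0).eval (bxor x (bxor s v))) = false) ∧ (∀ u ∈ S, ((Finset.univ.filter fun i => u i && v i).card).bodd = false) ∧ v ∉ U) →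
          (∃ r : ℕ, r ≤ m + m + 1 ∧ (2 : ℝ) ^ ((m + m) * r) / ((m + m + 2 : ℝ) ^ 8) ≤ (∑ xs : Fin (r) → (Fin (m + m) → Bool), (((@Finset.filter (Fin (m + m) → Bool) (fun v => v ∉ S ∧ (∃ V : Finset (Fin (m + m) → Bool), ((zeroVec ∈ V ∧ ∀ x ∈ V, ∀ y ∈ V, bxor x y ∈ V) ∧ (((V).card : ℝ) ^ 2 = (2 : ℝ) ^ (m + m)) ∧ ∀ u ∈ V, ∀ v ∈ V, ∀ x, ((C 1).eval x ^^ (C 1).eval (bxor x u) ^^ (C 1).eval (bxor x v) ^^ (C 1).eval (bxor x (bxor u v))) = false) ∧ S ⊆ V ∧ v ∈ V ∧ (∀ s ∈ V, ∀ u ∈ U, ((Finset.univ.filter fun i => s i && u i).card).bodd = false))) (Classical.decPred _) (Finset.univ.filter fun (v : Fin (m + m) → Bool) => (∀ s ∈ S, ∀ x, ((C 1).eval x ^^ (C 1).eval (bxor x s) ^^ (C 1).eval (bxor x v) ^^ (C 1).eval (bxor x (bxor s v))) = false) ∧ (∀ u ∈ U, ((Finset.univ.filter fun i => u i && v i).card).bodd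 = false) ∧ ∀ j, (∀ y z : Fin (m + m) → Bool, (((C 1).eval z ^^ (C 1).eval (bxor z (xs j)) ^^ (C 1).eval (bxor z v) ^^ (C 1).eval (bxor z (bxor (xs j) v))) ^^ ((C 1).eval (bxor z y) ^^ (C 1).eval (bxor (bxor z y) (xs j)) ^^ (C 1).eval (bxor (bxor z y) v) ^^ (C 1).eval (bxor (bxor z y) (bxor (xs j) v)))) = false))).card : ℝ) / (((Finset.univ.filter fun (v : Fin (m + m) → Bool) => (∀ s ∈ S, ∀ x, ((C 1).eval x ^^ (C 1).eval (bxor x s) ^^ (C 1).eval (bxor x v) ^^ (C 1).eval (bxor x (bxor s v))) = false) ∧ (∀ u ∈ U, ((Finset.univ.filter fun i => u i && v i).card).bodd = false) ∧ ∀ j, (∀ y z : Fin (m + m) → Bool, (((C 1).eval z ^^ (C 1).eval (bxor z (xs j)) ^^ (C 1).eval (bxor z v) ^^ (C 1).eval (bxor z (bxor (xs j) v))) ^^ ((C 1).eval (bxor z y) ^^ (C 1).eval (bxor (bxor z y) (xs j)) ^^ (C 1).eval (bxor (bxor z y) v) ^^ (C 1).eval (bxor (bxor z y) (bxor (xs j)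 v)))) = false))).card : ℝ)))) ∨
          (∃ r : ℕ, r ≤ m + m + 1 ∧ (2 : ℝ) ^ ((m + m) * r) / ((m + m + 2 : ℝ) ^ 8) ≤ (∑ xs : Fin (r) → (Fin (m + m) → Bool), (((@Finset.filter (Fin (m + m) → Bool) (fun v => v ∉ U ∧ (∃ V : Finset (Fin (m + m) → Bool), ((zeroVec ∈ V ∧ ∀ x ∈ V, ∀ y ∈ V, bxor x y ∈ V) ∧ (((V).card : ℝ) ^ 2 = (2 : ℝ) ^ (m + m)) ∧ ∀ u ∈ V, ∀ v ∈ V, ∀ x, ((C 0).eval x ^^ (C 0).eval (bxor x u) ^^ (C 0).eval (bxor x v) ^^ (C 0).eval (bxor x (bxor u v))) = false) ∧ U ⊆ V ∧ v ∈ V ∧ (∀ s ∈ V, ∀ u ∈ S, ((Finset.univ.filter fun i => s i && u i).card).bodd = false))) (Classical.decPred _) (Finset.univ.filter fun (v : Fin (m + m) → Bool) => (∀ s ∈ U, ∀ x, ((C 0).eval x ^^ (C 0).eval (bxor x s) ^^ (C 0).eval (bxor x v) ^^ (C 0).eval (bxor x (bxor s v))) = false) ∧ (∀ u ∈ S, ((Finset.univ.filter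 fun i => u i && v i).card).bodd = false) ∧ ∀ j, (∀ y z : Fin (m + m) → Bool, (((C 0).eval z ^^ (C 0).eval (bxor z (xs j)) ^^ (C 0).eval (bxor z v) ^^ (C 0).eval (bxor z (bxor (xs j) v))) ^^ ((C 0).eval (bxor z y) ^^ (C 0).eval (bxor (bxor z y) (xs j)) ^^ (C 0).eval (bxor (bxor z y) v) ^^ (C 0).eval (bxor (bxor z y) (bxor (xs j) v)))) = false))).card : ℝ) / (((Finset.univ.filter fun (v : Fin (m + m) → Bool) => (∀ s ∈ U, ∀ x, ((C 0).eval x ^^ (C 0).eval (bxor x s) ^^ (C 0).eval (bxor x v) ^^ (C 0).eval (bxor x (bxor s v))) = false) ∧ (∀ u ∈ S, ((Finset.univ.filter fun i => u i && v i).card).bodd = false) ∧ ∀ j, (∀ y z : Fin (m + m) → Bool, (((C 0).eval z ^^ (C 0).eval (bxor z (xs j)) ^^ (C 0).eval (bxor z v) ^^ (C 0).eval (bxor z (bxor (xs j) v))) ^^ ((C 0).eval (bxor z y) ^^ (C 0).eval (bxor (bxor z y) (xs j)) ^^ (C 0).eval (bxor (bxor z y) v) ^^ (C 0).eval (bxor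 (bxor z y) (bxor (xs j) v)))) = false))).card : ℝ)))) := by
  intro H1 _H2 H3 H4 m C hB hdeg hΦ horb S U hS hU hcb hca ho hSlt hUlt habsB habsA
  obtain ⟨e, ⟨M, c, hM⟩, perm, h, hbt⟩ := horb
  by_cases hA : ∃ u : Fin m → Bool, u ≠ zeroVec ∧
      ((∀ v w : Fin m → Bool, ((Finset.univ.filter fun i => u i && (perm (bxor v w) i ^^ perm v i ^^ perm w i ^^ perm zeroVec i)).card).bodd = false) ∨
       (∀ v w : Fin m → Bool, ((Finset.univ.filter fun i => u i && (perm.symm (bxor v w) i ^^ perm.symm v i ^^ perm.symm w i ^^ perm.symm zeroVec i)).card).bodd = false))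
  · -- an affine component on `perm` or on `perm⁻¹`: rich rectangular data (H3), same instance, same pair
    exact H3 m C hB hdeg hΦ ⟨e, ⟨M, c, hM⟩, perm, h, hbt, hA⟩ S U hS hU hcb hca ho hSlt hUlt habsB habsA
  · -- `perm` and `perm⁻¹` affine-free
    have hAF : ∀ u : Fin m → Bool, u ≠ zeroVec → ∃ v w : Fin m → Bool,
        ((Finset.univ.filter fun i => u i && (perm (bxor v w) i ^^ perm v i ^^ perm w i ^^ perm zeroVec i)).card).bodd = true := by
      intro u hu
      by_contra hne
      push Not at hne
      exact hA ⟨u, hu, Or.inl fun v w => Bool.eq_false_iff.2 (hne v w)⟩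
    have hAF' : ∀ u : Fin m → Bool, u ≠ zeroVec → ∃ v w : Fin m → Bool,
        ((Finset.univ.filter fun i => u i && (perm.symm (bxor v w) i ^^ perm.symm v i ^^ perm.symm w i ^^ perm.symm zeroVec i)).card).bodd = true := by
      intro u hu
      by_contra hne
      push Not at hne
      exact hA ⟨u, hu, Or.inr fun v w => Bool.eq_false_iff.2 (hne v w)⟩
    -- `perm^{±1}` quadratic, hence cube-type by the classification; `m = 3k`, `0 < k`
    obtain ⟨hperm2, hsymm2⟩ :=
      perm_quadratic (C 0).eval (C 1).eval (hdeg 0) (hdeg 1) hΦ e M c hM perm h hbt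
    obtain ⟨k, E₁, E₂, hE₁, hE₂, hcube⟩ := H1 m perm hperm2 hsymm2 hAF hAF'
    have hm : m = k * 3 := coreReduction_cubeBlocks ⟨E₁⟩
    subst hm
    have hk : 0 < k := coreReduction_blocksPos S hS.1 hSlt
    -- the cube-orbit datum of the same `b`, and (H4) at the same pair
    have key := H4 k hk C hB hdeg hΦ (cubeOrbitDatum (C 1).eval e M c hM perm h hbt E₁ E₂ hE₁ hE₂ hcube) S U hS hU
      hcb hca ho hSlt hUlt habsB habsA
    have ecast : ((k * 3 : ℕ) : ℝ) = (k : ℝ) * 3 := by push_cast; ring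
    rw [ecast]
    exact key

end Summit.QuantumAdvantage.QuantumAdvantage.Theorems.SignedExactCubicForrelationNotPrBPP
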